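import Literature.NumberTheory.Automorphic.BorelTorusUnipotent
import Literature.NumberTheory.Automorphic.TorusWeightModulus
import Literature.NumberTheory.Automorphic.WhittakerTowerChain
import Literature.NumberTheory.Automorphic.WhittakerTowerCoeff
import Literature.NumberTheory.Automorphic.RatPointsCoveringWeights
import Literature.NumberTheory.Automorphic.RankinSelbergTorusPositivity
import HarnessLib

/-!
# The bottom of the Whittaker tower is the unfolded Rankin–Selberg integral in torus coordinates

Topic `NumberTheory/Automorphic`; namespace `Literature.NumberTheory.Automorphic`. The junction
between the two halves of the real-point Rankin–Selberg method on `GL_n` in the tree: the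
inequality chain of `WhittakerTowerChain` ends at the bottom integral
`I^{(0)} = ∫_G ‖Φ_0‖² w β_0 dν` (`Φ_0 = W_φ` the Whittaker function, `WhittakerTowerCoeff`; `β_0` an
`N_n(K)`-covering weight), while the Euler lower bound of `RankinSelbergTorusIntegral` is stated for
`rankinSelbergTorusIntegral νA νK W Φ σ = ∫_{(𝔸ˣ)ⁿ × K} |W(diag(a) k)|² Φ(e_n diag(a) k) torusWeight σ a`.
With the Rankin–Selberg weight

  `rsWeight Φ σ g = Φ(e_n g) |det g|_𝔸^σ`  (**definition**; left `N_n(𝔸_K)`- and `P_n(K)`-invariant: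
  `rsWeight_unipotent_mul`, `rsWeight_ratMirabolic_mul` — the product formula),

the Iwasawa evaluation of `BorelTorusUnipotent` (`∫_G F β = C ∫_T ∫_K F(t k) δ_B(t)⁻¹`), the identity
`torusWeight σ a = |det diag(a)|^σ δ_B(a)⁻¹` (`TorusWeightModulus`) and `|det k|_𝔸 = 1` on `K`
(`RatPointsCoveringWeights`) give the **comparison**

* `lintegral_towerFun_zero_rsWeight_eq` —
  `∫_G towerFun 0 φ (rsWeight Φ σ) · β dν = C · rankinSelbergTorusIntegral νA νK (whittakerDepth 0 φ) Φ σ`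
  with `0 < C < ∞` independent of `φ`, `Φ`, `σ`, `β` (`νA`, `νK` Haar measures);
* `lintegral_towerFun_zero_rsWeight_eq_whittakerCoeff` — the same with `whittakerDepth 0 φ` replaced by
  the tree's `whittakerCoeff ν₀ (unipotentTateDomain n K) (adeleAddChar K) φ` (`WhittakerTowerCoeff`).

Hence finiteness of the top of the tower gives `rankinSelbergTorusIntegral < ∞`, the hypothesis `hfin`
of `exists_prod_schurSelfSum_le_of_rankinSelbergTorusIntegral_ne_top`. Everything is proved.

Measurable structures: as in `RankinSelbergTorusIntegral` / `JacquetShalikaSchurSelfSumOfTorusFiniteness`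
— an abstract Borel structure on the idele group, the product structure on `(𝔸_Kˣ)ⁿ`, the Borel
structure `adelicBorel` on `GL_n(𝔸_K) = (AdelicGroupData.gl n K).Adelic` and `glAdeleBorel`
(`SiegelSetVolume`) on the definitionally equal `GL (Fin n) (AdeleRing (𝓞 K) K)` (the spelling of the
Whittaker tower files); the maximal compact subgroup in the spelling `maximalCompactAdelic n K`
(definitionally `standardMaximalCompactGL n K`).

## References

* J. W. Cogdell, *Analytic theory of L-functions for GL_n*, in *An Introduction to the Langlands
  Program* (2004), §2.3 [CogdellAnalyticTheory2004].
* H. Jacquet, J. A. Shalika, Amer. J. Math. 103 (1981), §4 [JacquetShalikaAJM1981].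
-/

noncomputable section

open MeasureTheory Measure NumberField IsDedekindDomain Matrix Set Filter Topology
open scoped MatrixGroups ENNReal NNReal
open Literature.NumberTheory.GaloisRepresentations (ideleGroup)

namespace Literature.NumberTheory.Automorphic

/-! ### The Rankin–Selberg weight `Φ(e_n g) |det g|^σ` -/

section Weight

variable {n : ℕ} {K : Type} [Field K] [NumberField K]

variable (n K) in
/-- **The Rankin–Selberg weight** `w(g) = Φ(e_n g) · |det g|_𝔸^σ ∈ [0, ∞]` on `GL_n(𝔸_K)` (the integrand
of the mirabolic Eisenstein series before averaging; Cogdell (2004), §2.3). [folklore] -/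
def rsWeight (Φ : (Fin n → AdeleRing (𝓞 K) K) → ℝ) (σ : ℝ) (g : GL (Fin n) (AdeleRing (𝓞 K) K)) : ℝ≥0∞ :=
  ENNReal.ofReal (Φ (lastRow n K g) *
    (IdeleClassGroup.ideleNorm K (Matrix.GeneralLinearGroup.det g) : ℝ) ^ σ)

/-- Unfolding lemma. [folklore] -/
theorem rsWeight_apply (Φ : (Fin n → AdeleRing (𝓞 K) K) → ℝ) (σ : ℝ) (g : GL (Fin n) (AdeleRing (𝓞 K) K)) :
    rsWeight n K Φ σ g = ENNReal.ofReal (Φ (lastRow n K g) *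
      (IdeleClassGroup.ideleNorm K (Matrix.GeneralLinearGroup.det g) : ℝ) ^ σ) := rfl

/-- **`e_n (p g) = e_n g` when the last row of `p` is `e_n`.** [folklore] -/
theorem lastRow_mul_of_lastRow (hn : 0 < n) {p : GL (Fin n) (AdeleRing (𝓞 K) K)}
    (hp : ∀ j : Fin n, (p : Matrix (Fin n) (Fin n) (AdeleRing (𝓞 K) K)) ⟨n - 1, Nat.sub_lt hn one_pos⟩ j =
      if (j : ℕ) + 1 = n then 1 else 0)
    (g : GL (Fin n) (AdeleRing (𝓞 K) K)) : lastRow n K (p * g) = lastRow n K g := by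
  have hvec : lastBasisVec n K ᵥ* (p : Matrix (Fin n) (Fin n) (AdeleRing (𝓞 K) K)) = lastBasisVec n K := by
    funext j
    rw [Matrix.vecMul, dotProduct, Finset.sum_eq_single (⟨n - 1, Nat.sub_lt hn one_pos⟩ : Fin n)]
    · unfold lastBasisVec
      rw [if_pos (by simp only; omega), one_mul, hp j]
    · intro i _ hi
      have : ¬ ((i : ℕ) + 1 = n) := fun h => hi (Fin.ext (by simp only; omega))
      unfold lastBasisVec
      rw [if_neg this, zero_mul]
    · intro h; exact (h (Finset.mem_univ _)).elim
  rw [lastRow, lastRow, Matrix.GeneralLinearGroup.coe_mul, ← Matrix.vecMul_vecMul, hvec]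

/-- The last row of a unitriangular matrix is `e_n`. [folklore] -/
theorem lastRow_entry_of_mem_upperUnitriangular (hn : 0 < n) {u : GL (Fin n) (AdeleRing (𝓞 K) K)}
    (hu : u ∈ upperUnitriangular (Fin n) (AdeleRing (𝓞 K) K)) (j : Fin n) :
    (u : Matrix (Fin n) (Fin n) (AdeleRing (𝓞 K) K)) ⟨n - 1, Nat.sub_lt hn one_pos⟩ j =
      if (j : ℕ) + 1 = n then 1 else 0 := by
  rw [mem_upperUnitriangular_iff] at hu
  by_cases hj : (j : ℕ) + 1 = n
  · have : (⟨n - 1, Nat.sub_lt hn one_pos⟩ : Fin n) = j := Fin.ext (by simp only; omega)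
    rw [if_pos hj, this, hu.2 j]
  · rw [if_neg hj]
    exact hu.1 (show j < (⟨n - 1, Nat.sub_lt hn one_pos⟩ : Fin n) from
      Fin.lt_def.2 (by have := j.2; simp only; omega))

/-- **`w` is left `N_n(𝔸_K)`-invariant**: `e_n u = e_n` and `det u = 1`. [folklore] -/
theorem rsWeight_unipotent_mul (Φ : (Fin n → AdeleRing (𝓞 K) K) → ℝ) (σ : ℝ) {u : GL (Fin n) (AdeleRing (𝓞 K) K)}
    (hu : u ∈ upperUnitriangular (Fin n) (AdeleRing (𝓞 K) K)) (g : GL (Fin n) (AdeleRing (𝓞 K) K)) :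
    rsWeight n K Φ σ (u * g) = rsWeight n K Φ σ g := by
  rcases Nat.eq_zero_or_pos n with hn | hn
  · subst hn
    have : u = 1 := Subsingleton.elim _ _
    rw [this, one_mul]
  rw [rsWeight_apply, rsWeight_apply, lastRow_mul_of_lastRow hn (lastRow_entry_of_mem_upperUnitriangular hn hu) g,
    map_mul, det_eq_one_of_mem_upperUnitriangular hu, one_mul]

/-- **`w` is left `P_n(K)`-invariant** (`P_n(K) = Q_{n-1}(K)` the rational mirabolic): `e_n γ = e_n` and
`|det γ|_𝔸 = 1` by the product formula. [folklore] -/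
theorem rsWeight_ratMirabolic_mul (Φ : (Fin n → AdeleRing (𝓞 K) K) → ℝ) (σ : ℝ) {γ₀ : GL (Fin n) K}
    (hγ : γ₀ ∈ tailUnipotent n K (n - 1)) (g : GL (Fin n) (AdeleRing (𝓞 K) K)) :
    rsWeight n K Φ σ (Matrix.GeneralLinearGroup.map (algebraMap K (AdeleRing (𝓞 K) K)) γ₀ * g) =
      rsWeight n K Φ σ g := by
  rcases Nat.eq_zero_or_pos n with hn | hn
  · subst hn
    have : Matrix.GeneralLinearGroup.map (algebraMap K (AdeleRing (𝓞 K) K)) γ₀ = 1 := Subsingleton.elim _ _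
    rw [this, one_mul]
  have hrow : ∀ j : Fin n, ((Matrix.GeneralLinearGroup.map (algebraMap K (AdeleRing (𝓞 K) K)) γ₀ :
      GL (Fin n) (AdeleRing (𝓞 K) K)) : Matrix (Fin n) (Fin n) (AdeleRing (𝓞 K) K)) ⟨n - 1, Nat.sub_lt hn one_pos⟩ j =
      if (j : ℕ) + 1 = n then 1 else 0 := by
    intro j
    have h := (mem_tailUnipotent_iff.1 hγ) ⟨n - 1, Nat.sub_lt hn one_pos⟩ j le_rfl
      (Fin.le_iff_val_le_val.2 (by have := j.2; simp only; omega))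
    change algebraMap K (AdeleRing (𝓞 K) K) ((γ₀ : Matrix (Fin n) (Fin n) K) ⟨n - 1, Nat.sub_lt hn one_pos⟩ j) = _
    rw [h]
    by_cases hj : (j : ℕ) + 1 = n
    · have : (⟨n - 1, Nat.sub_lt hn one_pos⟩ : Fin n) = j := Fin.ext (by simp only; omega)
      rw [if_pos this, if_pos hj, map_one]
    · have : (⟨n - 1, Nat.sub_lt hn one_pos⟩ : Fin n) ≠ j := fun h => hj (by rw [← h]; simp only; omega)
      rw [if_neg this, if_neg hj, map_zero]
  have hdet : IdeleClassGroup.ideleNorm K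
      (Matrix.GeneralLinearGroup.det (Matrix.GeneralLinearGroup.map (algebraMap K (AdeleRing (𝓞 K) K)) γ₀)) = 1 := by
    rw [Matrix.GeneralLinearGroup.map_det]
    exact ideleNorm_principal ⟨Matrix.GeneralLinearGroup.det γ₀, rfl⟩
  rw [rsWeight_apply, rsWeight_apply, lastRow_mul_of_lastRow hn hrow g, map_mul, map_mul, hdet, one_mul]

/-- **`|det (t k)|_𝔸 = |det t|_𝔸` on the maximal compact subgroup** (`maximalCompactAdelic`, the spelling
of `RankinSelbergTorusIntegral`). [folklore] -/
theorem ideleNorm_det_mul_maximalCompactAdelic (t : GL (Fin n) (AdeleRing (𝓞 K) K)) (k : ↥(maximalCompactAdelic n K)) :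
    IdeleClassGroup.ideleNorm K (Matrix.GeneralLinearGroup.det
      (t * (show GL (Fin n) (AdeleRing (𝓞 K) K) from (k : (AdelicGroupData.gl n K).Adelic)))) =
      IdeleClassGroup.ideleNorm K (Matrix.GeneralLinearGroup.det t) :=
  ideleNorm_det_mul_eq_of_isCompact (U₀ := (standardMaximalCompactGL n K)) (isCompact_standardMaximalCompactGL n K) t k.2

end Weight

/-! ### The comparison -/

section Comparison

variable {n : ℕ} {K : Type} [Field K] [NumberField K]
variable [MeasurableSpace (ideleGroup K)] [BorelSpace (ideleGroup K)]

-- Borel structures: `adelicBorel` on `(AdelicGroupData.gl n K).Adelic` (the spelling of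
-- `RankinSelbergTorusIntegral`) and `glAdeleBorel` of `SiegelSetVolume` on the definitionally equal
-- `GL (Fin n) (AdeleRing (𝓞 K) K)` (the spelling of the Whittaker tower); both are `borel _`.
attribute [local instance] adelicBorel borelSpace_adelic glAdeleBorel borelSpace_glAdele

/-- **Measurability of the torus integrand** for continuous `W` and `Φ` with `g ↦ Φ(e_n g)` measurable.
[folklore] -/
theorem measurable_torusIntegrand {W : GL (Fin n) (AdeleRing (𝓞 K) K) → ℂ} (hW : Continuous W)
    {Φ : (Fin n → AdeleRing (𝓞 K) K) → ℝ} (hΦm : Measurable fun g : GL (Fin n) (AdeleRing (𝓞 K) K) => Φ (lastRow n K g))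
    (σ : ℝ) : Measurable (torusIntegrand n K W Φ σ) := by
  haveI := secondCountableTopology_ideleGroup K
  haveI : SecondCountableTopology (GL (Fin n) (AdeleRing (𝓞 K) K)) := secondCountableTopology_generalLinearGroup_adeleRing K (Fin n)
  haveI : SecondCountableTopology (AdelicGroupData.gl n K).Adelic := secondCountableTopology_generalLinearGroup_adeleRing K (Fin n)
  haveI : SecondCountableTopology ↥(maximalCompactAdelic n K) := TopologicalSpace.Subtype.secondCountableTopology _
  unfold torusIntegrand
  refine ENNReal.measurable_ofReal.comp ?_
  have hpt : Measurable (torusPoint n K) := continuous_torusPoint.measurable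
  exact (((hW.measurable.comp hpt).norm.pow_const 2).mul (hΦm.comp hpt)).mul
    ((continuous_torusWeight σ).measurable.comp measurable_fst)

/-- Measurability of the Rankin–Selberg weight. [folklore] -/
theorem measurable_rsWeight {Φ : (Fin n → AdeleRing (𝓞 K) K) → ℝ}
    (hΦm : Measurable fun g : GL (Fin n) (AdeleRing (𝓞 K) K) => Φ (lastRow n K g)) (σ : ℝ) :
    Measurable (rsWeight n K Φ σ) := by
  unfold rsWeight
  refine ENNReal.measurable_ofReal.comp (hΦm.mul ?_)
  exact (measurable_subtype_coe.comp ((continuous_ideleNorm_holds K).measurable.comp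
    Matrix.GeneralLinearGroup.continuous_det.measurable)).pow_const _

omit [MeasurableSpace (ideleGroup K)] [BorelSpace (ideleGroup K)] in
/-- `δ_{[0,n-1]} = δ_{[1,n-1]}` (the range `[0,0]` is trivial). [folklore] -/
theorem colRangeDiagModulus_zero_eq_one_range (hn : 0 < n) (a : Fin n → ideleGroup K) :
    (colRangeDiagModulus (n := n) (K := K) 0 (n - 1) a : ℝ≥0∞) = colRangeDiagModulus (n := n) (K := K) 1 (n - 1) a := by
  haveI := locallyCompactSpace_adeleRing' K
  rw [colRangeDiagModulus_split (a := 0) (b := n - 1) 0 (by omega) (Nat.zero_le _) a, ENNReal.coe_mul,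
    colRangeDiagModulus_zero_zero hn a, mul_one]

omit [MeasurableSpace (ideleGroup K)] [BorelSpace (ideleGroup K)] in
/-- `torusWeight σ a = |det diag(a)|^σ · δ_{[1,n-1]}(a)⁻¹` (`ofReal_torusWeight_eq` with the modulus on
`U_{[1,n-1]} = N_n`). [folklore] -/
theorem ofReal_torusWeight_eq_one (hn : 0 < n) (σ : ℝ) (a : Fin n → ideleGroup K) :
    ENNReal.ofReal (torusWeight n K σ a) =
      ENNReal.ofReal ((IdeleClassGroup.ideleNorm K
        (Matrix.GeneralLinearGroup.det (glDiagonal n (AdeleRing (𝓞 K) K) a)) : ℝ) ^ σ) *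
        ((colRangeDiagModulus (n := n) (K := K) 1 (n - 1) a : ℝ≥0∞))⁻¹ := by
  haveI := locallyCompactSpace_adeleRing' K
  rw [ofReal_torusWeight_eq hn σ a, colRangeDiagModulus_zero_eq_one_range hn a]

/-- **The bottom of the Whittaker tower is `C ·` the unfolded Rankin–Selberg torus integral.** Let `0 < n`,
`ν` a Haar measure on `GL_n(𝔸_K)`, `νA` a Haar measure on `(𝔸_Kˣ)ⁿ` and `νK` a Haar measure on
`K = maximalCompactAdelic n K = standardMaximalCompactGL n K`. There is `C ∈ (0, ∞)`, depending only on the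
measures, such that for every `φ : GL_n(𝔸_K) → ℂ` continuous and left `GL_n(K)`-invariant, every `Φ ≥ 0`
with `g ↦ Φ(e_n g)` measurable, every `σ ∈ ℝ` and every measurable `N_n(K)`-covering weight `β`,

  `∫_G towerFun 0 φ (rsWeight Φ σ) · β dν = C · rankinSelbergTorusIntegral νA νK (whittakerDepth 0 φ) Φ σ`.

(`exists_lintegral_mul_weight_eq_mul_lintegral_torus_maximalCompact` with `F = ‖Φ_0‖² w`, left
`N_n(𝔸_K)`-invariant; `F(diag(a) k) δ_B(a)⁻¹ = torusIntegrand (a, k)` by `ofReal_torusWeight_eq` and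
`|det k|_𝔸 = 1`; Tonelli.) [folklore] -/
theorem lintegral_towerFun_zero_rsWeight_eq (hn : 0 < n)
    (ν : Measure (GL (Fin n) (AdeleRing (𝓞 K) K))) [IsHaarMeasure ν]
    (νA : Measure (Fin n → ideleGroup K)) [IsHaarMeasure νA]
    (νK : Measure ↥(maximalCompactAdelic n K)) [IsHaarMeasure νK] :
    ∃ C : ℝ≥0∞, C ≠ 0 ∧ C ≠ ⊤ ∧
      ∀ {φ : GL (Fin n) (AdeleRing (𝓞 K) K) → ℂ}, Continuous φ →
        (∀ (γ₀ : GL (Fin n) K) (x : GL (Fin n) (AdeleRing (𝓞 K) K)),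
          φ (Matrix.GeneralLinearGroup.map (algebraMap K (AdeleRing (𝓞 K) K)) γ₀ * x) = φ x) →
      ∀ {Φ : (Fin n → AdeleRing (𝓞 K) K) → ℝ}, (∀ y, 0 ≤ Φ y) →
        (Measurable fun g : GL (Fin n) (AdeleRing (𝓞 K) K) => Φ (lastRow n K g)) →
      ∀ (σ : ℝ) {β : GL (Fin n) (AdeleRing (𝓞 K) K) → ℝ≥0∞}, Measurable β →
        (∀ x, Literature.MeasureTheory.Group.coveringSum ↥(ratPoints (tailUnipotent n K 0)) β x = 1) →
        ∫⁻ x, towerFun 0 φ (rsWeight n K Φ σ) x * β x ∂ν =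
          C * rankinSelbergTorusIntegral n K νA νK (whittakerDepth 0 φ) Φ σ := by
  haveI := secondCountableTopology_ideleGroup K
  haveI := locallyCompactSpace_ideleGroup K
  haveI : SecondCountableTopology (GL (Fin n) (AdeleRing (𝓞 K) K)) := secondCountableTopology_generalLinearGroup_adeleRing K (Fin n)
  haveI : SecondCountableTopology (AdelicGroupData.gl n K).Adelic := secondCountableTopology_generalLinearGroup_adeleRing K (Fin n)
  haveI : SecondCountableTopology ↥(maximalCompactAdelic n K) := TopologicalSpace.Subtype.secondCountableTopology _
  haveI : SecondCountableTopology ↥(standardParabolicGL (AdeleRing (𝓞 K) K) (id : Fin n → Fin n)) :=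
    TopologicalSpace.Subtype.secondCountableTopology _
  haveI : SecondCountableTopology ↥(leviP (AdeleRing (𝓞 K) K) (id : Fin n → Fin n)) := TopologicalSpace.Subtype.secondCountableTopology _
  haveI : CompactSpace ↥(maximalCompactAdelic n K) := isCompact_iff_compactSpace.1 (isCompact_maximalCompactAdelic n K)
  haveI := locallyCompactSpace_adeleRing' K
  -- the torus measure transported to `T ≤ B`
  set eT := (borelTorusEquiv (n := n) (K := K)) with heT
  set μT : Measure ↥(leviP (AdeleRing (𝓞 K) K) (id : Fin n → Fin n)) := νA.map eT with hμT
  haveI : IsHaarMeasure μT := eT.isHaarMeasure_map νA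
  -- the Iwasawa evaluation (the maximal compact subgroup in the spelling `maximalCompactAdelic`, the same
  -- group as `standardMaximalCompactGL n K`)
  obtain ⟨C, hC0, hCtop, hmain⟩ :=
    @exists_lintegral_mul_weight_eq_mul_lintegral_torus_maximalCompact n K _ _ _ _ hn ν _ μT _ νK
      (inferInstance : IsHaarMeasure νK)
  refine ⟨C, hC0, hCtop, fun {φ} hφ hφK {Φ} hΦ0 hΦm σ {β} hβm hβ => ?_⟩
  -- the integrand `F = ‖Φ_0‖² w` and its invariance
  have hw := measurable_rsWeight (n := n) (K := K) hΦm σ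
  have hF : Measurable (towerFun 0 φ (rsWeight n K Φ σ)) := measurable_towerFun 0 hφ hw
  have hFN : ∀ u : GL (Fin n) (AdeleRing (𝓞 K) K), u ∈ adelicColRange n K 1 (n - 1) →
      ∀ x, towerFun 0 φ (rsWeight n K Φ σ) (u * x) = towerFun 0 φ (rsWeight n K Φ σ) x := by
    intro u hu x
    have hu' : u ∈ adelicColRange n K (0 + 1) (n - 1) := by rw [zero_add]; exact hu
    exact towerFun_colRange_mul hn hφK (fun u hu x => rsWeight_unipotent_mul Φ σ hu x) ⟨u, hu'⟩ x
  rw [hmain hF hFN hβm hβ]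
  congr 1
  -- the inner integral in the spelling `maximalCompactAdelic` (the same type and measure)
  change ∫⁻ t, ∫⁻ k : ↥(maximalCompactAdelic n K),
      towerFun 0 φ (rsWeight n K Φ σ) (((t : ↥(standardParabolicGL (AdeleRing (𝓞 K) K) (id : Fin n → Fin n))) :
        GL (Fin n) (AdeleRing (𝓞 K) K)) * (show GL (Fin n) (AdeleRing (𝓞 K) K) from (k : (AdelicGroupData.gl n K).Adelic))) *
        ((colRangeDiagModulus (n := n) (K := K) 1 (n - 1)
          (borelDiagUnit (t : ↥(standardParabolicGL (AdeleRing (𝓞 K) K) (id : Fin n → Fin n)))) : ℝ≥0∞))⁻¹ ∂νK ∂μT = _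
  -- pass to the coordinates `a ∈ (𝔸ˣ)ⁿ`
  have hmeq : ∀ G : ↥(leviP (AdeleRing (𝓞 K) K) (id : Fin n → Fin n)) → ℝ≥0∞, Measurable G → ∫⁻ t, G t ∂μT = ∫⁻ a, G (eT a) ∂νA := by
    intro G hG
    rw [hμT, lintegral_map hG (show Measurable fun a => eT a from eT.continuous.measurable)]
  -- the inner integrand in torus coordinates is `torusIntegrand`
  have hpt : ∀ (a : Fin n → ideleGroup K) (k : ↥(maximalCompactAdelic n K)),
      towerFun 0 φ (rsWeight n K Φ σ) ((((eT a : ↥(leviP (AdeleRing (𝓞 K) K) (id : Fin n → Fin n))) : ↥(standardParabolicGL (AdeleRing (𝓞 K) K) (id : Fin n → Fin n))) :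
        GL (Fin n) (AdeleRing (𝓞 K) K)) * (show GL (Fin n) (AdeleRing (𝓞 K) K) from (k : (AdelicGroupData.gl n K).Adelic))) *
        ((colRangeDiagModulus (n := n) (K := K) 1 (n - 1) (borelDiagUnit ((eT a : ↥(leviP (AdeleRing (𝓞 K) K) (id : Fin n → Fin n))) : ↥(standardParabolicGL (AdeleRing (𝓞 K) K) (id : Fin n → Fin n)))) : ℝ≥0∞))⁻¹ =
      torusIntegrand n K (whittakerDepth 0 φ) Φ σ (a, k) := by
    intro a k
    have hcoe : ((((eT a : ↥(leviP (AdeleRing (𝓞 K) K) (id : Fin n → Fin n))) : ↥(standardParabolicGL (AdeleRing (𝓞 K) K) (id : Fin n → Fin n))) : GL (Fin n) (AdeleRing (𝓞 K) K))) =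
        glDiagonal n (AdeleRing (𝓞 K) K) a := rfl
    have hunit : borelDiagUnit ((eT a : ↥(leviP (AdeleRing (𝓞 K) K) (id : Fin n → Fin n))) : ↥(standardParabolicGL (AdeleRing (𝓞 K) K) (id : Fin n → Fin n))) = a :=
      borelDiagUnit_borelTorusEquiv a
    rw [hcoe, hunit, towerFun, rsWeight_apply, ideleNorm_det_mul_maximalCompactAdelic, mul_assoc,
      ENNReal.ofReal_mul (hΦ0 _), mul_assoc, ← ofReal_torusWeight_eq_one hn σ a, torusIntegrand,
      ENNReal.ofReal_mul (mul_nonneg (sq_nonneg _) (hΦ0 _)), ENNReal.ofReal_mul (sq_nonneg _), ← mul_assoc]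
    rfl
  -- Tonelli
  have hTI : Measurable (torusIntegrand n K (whittakerDepth 0 φ) Φ σ) :=
    measurable_torusIntegrand (continuous_whittakerDepth hφ 0) hΦm σ
  have hG : Measurable fun t : ↥(leviP (AdeleRing (𝓞 K) K) (id : Fin n → Fin n)) => ∫⁻ k : ↥(maximalCompactAdelic n K),
      towerFun 0 φ (rsWeight n K Φ σ) (((t : ↥(standardParabolicGL (AdeleRing (𝓞 K) K) (id : Fin n → Fin n))) : GL (Fin n) (AdeleRing (𝓞 K) K)) * (show GL (Fin n) (AdeleRing (𝓞 K) K) from (k : (AdelicGroupData.gl n K).Adelic))) *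
        ((colRangeDiagModulus (n := n) (K := K) 1 (n - 1) (borelDiagUnit (t : ↥(standardParabolicGL (AdeleRing (𝓞 K) K) (id : Fin n → Fin n)))) : ℝ≥0∞))⁻¹ ∂νK := by
    -- as a function of `t = eT a` it is the marginal of the measurable `torusIntegrand`
    have h1 : (fun t : ↥(leviP (AdeleRing (𝓞 K) K) (id : Fin n → Fin n)) => ∫⁻ k : ↥(maximalCompactAdelic n K),
        towerFun 0 φ (rsWeight n K Φ σ) (((t : ↥(standardParabolicGL (AdeleRing (𝓞 K) K) (id : Fin n → Fin n))) : GL (Fin n) (AdeleRing (𝓞 K) K)) * (show GL (Fin n) (AdeleRing (𝓞 K) K) from (k : (AdelicGroupData.gl n K).Adelic))) *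
          ((colRangeDiagModulus (n := n) (K := K) 1 (n - 1) (borelDiagUnit (t : ↥(standardParabolicGL (AdeleRing (𝓞 K) K) (id : Fin n → Fin n)))) : ℝ≥0∞))⁻¹ ∂νK) =
        (fun a : Fin n → ideleGroup K => ∫⁻ k : ↥(maximalCompactAdelic n K),
          torusIntegrand n K (whittakerDepth 0 φ) Φ σ (a, k) ∂νK) ∘ eT.symm := by
      funext t
      simp only [Function.comp_apply]
      conv_lhs => rw [← eT.apply_symm_apply t]
      exact lintegral_congr fun k => hpt _ k
    rw [h1]
    exact (hTI.lintegral_prod_right').comp eT.symm.continuous.measurable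
  rw [hmeq _ hG]
  simp_rw [hpt]
  rw [rankinSelbergTorusIntegral, lintegral_prod _ hTI.aemeasurable]

/-- **The same with the tree's global Whittaker coefficient**: for `0 < n` (so `1 ≤ n`) and a Haar
measure `ν₀` on `N_n(𝔸_K)`, `whittakerDepth 0 φ = whittakerCoeff ν₀ (unipotentTateDomain n K) (adeleAddChar K) φ`
(`whittakerDepth_zero_eq_whittakerCoeff`), so the bottom of the tower is `C ·` the unfolded
Rankin–Selberg integral of the Whittaker coefficient `W_φ` of `RankinSelbergTorusIntegral`. [folklore] -/
theorem lintegral_towerFun_zero_rsWeight_eq_whittakerCoeff (hn : 0 < n)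
    (ν : Measure (GL (Fin n) (AdeleRing (𝓞 K) K))) [IsHaarMeasure ν]
    (νA : Measure (Fin n → ideleGroup K)) [IsHaarMeasure νA]
    (νK : Measure ↥(maximalCompactAdelic n K)) [IsHaarMeasure νK]
    (ν₀ : Measure ↥(adelicUnipotent n K)) [IsHaarMeasure ν₀] :
    ∃ C : ℝ≥0∞, C ≠ 0 ∧ C ≠ ⊤ ∧
      ∀ {φ : GL (Fin n) (AdeleRing (𝓞 K) K) → ℂ}, Continuous φ →
        (∀ (γ₀ : GL (Fin n) K) (x : GL (Fin n) (AdeleRing (𝓞 K) K)),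
          φ (Matrix.GeneralLinearGroup.map (algebraMap K (AdeleRing (𝓞 K) K)) γ₀ * x) = φ x) →
      ∀ {Φ : (Fin n → AdeleRing (𝓞 K) K) → ℝ}, (∀ y, 0 ≤ Φ y) →
        (Measurable fun g : GL (Fin n) (AdeleRing (𝓞 K) K) => Φ (lastRow n K g)) →
      ∀ (σ : ℝ) {β : GL (Fin n) (AdeleRing (𝓞 K) K) → ℝ≥0∞}, Measurable β →
        (∀ x, Literature.MeasureTheory.Group.coveringSum ↥(ratPoints (tailUnipotent n K 0)) β x = 1) →
        ∫⁻ x, towerFun 0 φ (rsWeight n K Φ σ) x * β x ∂ν =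
          C * rankinSelbergTorusIntegral n K νA νK
            (whittakerCoeff ν₀ (unipotentTateDomain n K) (adeleAddChar K) φ) Φ σ := by
  obtain ⟨C, hC0, hCtop, h⟩ := lintegral_towerFun_zero_rsWeight_eq hn ν νA νK
  refine ⟨C, hC0, hCtop, fun {φ} hφ hφK {Φ} hΦ0 hΦm σ {β} hβm hβ => ?_⟩
  have hW : whittakerDepth 0 φ = whittakerCoeff ν₀ (unipotentTateDomain n K) (adeleAddChar K) φ :=
    funext fun g => whittakerDepth_zero_eq_whittakerCoeff hφ hn ν₀ g
  rw [← hW]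
  exact h hφ hφK hΦ0 hΦm σ hβm hβ

end Comparison

end Literature.NumberTheory.Automorphic
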